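import Summits.QuantumFields.YangMills.Theorems.UnitScaleTiltProp8HalvingELJunction
import Literature.MathematicalPhysics.QuantumFieldTheory.Balaban1983to89.B8Eq12HodgeLaplacianV1
import HarnessLib

/-!
# N07 [B11] (= [15] = [Balaban1985Variational]) Sect. F at NODE 00's flat operators, WIDTH-209 piece 4: **PRINT'S ROAD (134)–(136) AT `U₀ = 1` FOR THE
# TANGENT COMPONENT `A₁`** — the componentwise-Laplacian member `|ΔA₁|` of (165) and the `∂∂*`-row of the Hodge door, from Eq. (158) on the Landau slice (153):
# `ΔA₁ = (∂*∂ + ∂∂*)A₁ = (−f + Q*(QGQ*)⁻¹QGf) + ∂(1 − R)∂*A₁` EXACTLY, hence `|ΔA₁| ≤ (V-slot) + (multiplier row) + (DPD* row)` and `|∂∂*A₁| ≤ (DPD* row)`,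
# the one operator estimate «`DPD*` bounded» = [B9] (3.49) p. 399 ENTERING AS A HYPOTHESIS (tree objects `B9.Ineq349`, `B9Ineq349MultiLevelTorus.ineq349_multiLevelTorus`
# live on other carriers; no V1 dictionary is claimed here)

Cell `pub-ymgap`, width seat `pub-ymgap-dag-n07-w8` g0 (director-ym R405 ∕ №209 second wave; dag-lead WIDTH-209 N07 piece 4, DEDUP-381b∕382 «consumer row only; cite (3.49)
and n07-w4's Hodge letter by name»).  `--kind proof --supports stmt-QuantumFields-20542 --as helper`; count-neutral.  [15] = T. Bałaban, *The variational problem and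
background fields in renormalization group method for lattice gauge theories*, Commun. Math. Phys. **102** (1985) 277–309 [Balaban1985Variational]; [B6] =
*Propagators and renormalization transformations for lattice gauge theories. II*, CMP **96** (1984) 223–250 [Balaban1984PropagatorsII]; [B5] = *… I*, CMP **95**
(1984) 17–40 [Balaban1984PropagatorsI]; [B9] = *Propagators for lattice gauge theories in a background field*, CMP **99** (1985) 389–434
[Balaban1985BackgroundPropagators].  PDF of [15] held as `paper:balaban1985-cmp102-variational-background` (journal page = PDF page + 276), pp. 296–299 and 301–304
read on the text layer this generation; [B9] pp. 397–399 likewise (`paper:balaban1985-cmp99-background-propagators`).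

THE PRINT.  [15] p. 302 (157)–(158): *«𝔊(A′) = ½⟨A′ − HD(A′), d^{η*}d^η(A′ − HD(A′))⟩ + V₀(A′ − HD(A′)), R∂*A′ = 0, LʲηQ_jA′ = B on Λ′_j … A₁ + G̃((δ∕δA′)V₁)(A₁ + HB)
= 0. (158) … all the operators in this section are taken without any external gauge field configuration»*; p. 297 (128): *«Δ_a = Δ + DRD* + Q*aQ»*; p. 298
(133)–(136): *«A₀ = −GP₀*J + … − GP₀*((δ∕δA′)V)(A₀ + H₀B) (133) … (Δ + DRD*)A₀ = (D*D + DD*)A₀ + (Δ′ − DPD*)A₀, (134) (D*DA₀)_μ(x) + (DD*A₀)_μ(x) =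
(Δ_{U₀}A₀,μ)(x) + … (135) … This way we have expressed (Δ + DRD*)A₀ as a sum of Δ_{U₀}A₀ and a bounded operator acting on A₀. The bound for this operator follows
from the inequality (3.49) [5] for DPD* … This together with (133) … implies the bound |Δ_{U₀}A₀|₍₋₃₎ ≦ O(1)C₁B₃ε₁ (136)»*; p. 299: *«we have used the equality
RD*H = 0»*; p. 304 (165): *«|A|, |∇A|, |d^{η*}d^ηA|, |ΔA| ≦ ⅛M_Δ max{B₃ε₁, ½ε₀} + B₀C₄(36dL²B₁Mε₀)² + …»*.  [B6] p. 226 (2.19): *«Δ_a = ∂*∂ + ∂R∂* + Q*aQ = Δ − ∂P∂* +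
Q*aQ»* (tree: `B6SectAVectorModelV1.deltaAE_def`) — so at `U₀ = 1` the `Δ` of (128)∕(134) is `∂*∂ = D*D` ([B9] (3.10) `Δ = D*D + Δ′`, `Δ′ = 0`), the third member
`∂*∂A₁ = Δ_aA₁ = −f + Q*(QGQ*)⁻¹QGf` of (165) is the equation's own Δ_a-row on the slice (route `UnitScaleTilt`: `HalvingELJunction.dcsE_dcE_eq_of_slice_of_eq_neg_Gt`,
USED BY NAME), and (134)–(136) serve the FOURTH member `|ΔA₁|` (= `Δ_{U₀} = D*D + DD*` at `U₀ = 1`, [B5] (1.69); tree `B8Eq12HodgeLaplacianV1.hodge_apply`,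
`N07SecondOrderLetterHodge.dcsE_dcE_apply_eq_laplace_sub`, USED BY NAME).  [B9] p. 399 (3.49): *«[|P(x,x′)|, |(DP)_μ(x,x′)|, |(PD*)_ν(x,x′)|, |(DPD*)_{μν}(x,x′)|] ≦
O(1)[1, (Lʲη)⁻¹, (Lʲη)⁻¹, (Lʲη)⁻²](L^{j′}η)^{−d}e^{−½δ₀d(y,y′)}»* for `P = I − R`.

WHAT IS PROVED (sorry-free; no definition; axioms standard).  `P : Params`, `D : B6SectADomainsV1.Domains P` ANY nested family, lattice factor `c ≠ 0`, weights
`w > 0`; `G := GE D hc hw`, `H := hOp G (QsE D) (EE D hc hw)` (print's `H`, (45)∕(157)), `G̃ := G − H∘QE∘G` ((143)), `𝔐φ := Q*((QGQ*)⁻¹(Q(Gφ)))` (the multiplier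
operator `1 − P₀ᵀ` of (131)∕(133)); real scalar bond fields `BondSpace P` (the 𝔤-valued fields of the heart act componentwise, p. 288; the passage to components is the
k0-s1 lane's `HalvingELJunction.linear_kernel` ∕ `K0Stub1Letter165GtLetterAtRecord.reFunctional_kernel`, not repeated).
* §1 `dE_dsE_eq_of_landau` — **`R∂*x = 0 ⇒ ∂∂*x = ∂(1 − R)∂*x`** (= `∂P∂*x`, `P = 1 − R` of [B9] (3.25)); `dE_dsE_tangent_eq` (the same for `A′ − Hβ` under (153) for
  `A′`, by `HalvingELJunction.RE_dsE_sub_hOp`).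
* §2 ★ `laplace_eq_of_slice_of_eq_neg_Gt` — **(134)–(135) AT `U₀ = 1`**: `R∂*x = 0 ∧ x = −G̃φ ⇒ (Δx_μ)(s) = (−φ + 𝔐φ)⟨s,μ⟩ + (∂(1−R)∂*x)⟨s,μ⟩` (the Laplacian of the
  solution = the equation's right-hand side + ONE operator applied to `x`; no curvature terms at the flat background); ★ `laplace_tangent_eq_of_eq158` (for
  `A₁ := A′ − H(QA′)` with `A₁ + G̃f = 0` and (153) for `A′` — the shape delivered by `K0Stub1Eq158FlatOpsMatrixFields.eq158_flatOps_matrixFields`, componentwise).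
* §3 ★ `curlCurlLetter_of_eq158` — the THIRD member at one bond as a weighted scalar letter (`ω|φ(b)| ≤ β₁ ∧ ω|(𝔐φ)(b)| ≤ β₂ ⇒ ω·|(∂*∂x)(b)| ≤ β₁ + β₂`; bookkeeping over
  the UST slice identity, by name); ★★ `hodgeRows_of_eq158` — **(136) AT `U₀ = 1`, ROW FORM AT ONE BOND `b`**: from the V-slot `|φ(b)| ≤ β₁` ([15] Prop. 4 (97)∕(98), hypothesis), the multiplier row
  `|(𝔐φ)(b)| ≤ β₂` ((133)∕(137), hypothesis — the k0-s1 lane's multiplier letter) and the `DPD*` ROW AT `b` against a weighted sup bound of `x`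
  (`hDPD : ∀ X, (∀ b′, ω₁ b′·|X b′| ≤ r) → |(∂(1−R)∂*X)(b)| ≤ C·r` — [B9] (3.49)'s fourth entry summed with [B6] Lemma 2.1, HYPOTHESIS) and the first letter
  `ω₁|x| ≤ r`: **`|(Δx_{dir b})(src b)| ≤ β₁ + β₂ + C·r ∧ |(∂∂*x)(b)| ≤ C·r`** — LITERALLY the `qΔ`∕`qP` inputs of n07-w4's door
  `N07SecondOrderLetterHodge.letters10On_of_realRows_hodge` for the component `x = φ ∘ 𝔄₁` (lattice factor `c = ξ⁻¹`); ★ `hodgeRows_tangent_of_eq158` (tangent edition);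
  `laplaceLetter_of_eq158` (weighted twin `ω(b)·|Δx| ≤ …` for the `wt 3` currency of `K0Stub1Letter165OfCriticalFlatOps`).
HONEST SCOPE.  Exact operator algebra and triangle-inequality bookkeeping at one finite lattice; every estimate is a HYPOTHESIS at the bond: the V-slot `β₁` (k0-s1-w2's (98)
slot), the multiplier row `β₂` (k0-s1-w4's `…K0Stub1MultiplierLetterP`, announced), the `DPD*` row `hDPD` ([B9] (3.49) p. 399 — tree: `B9.Ineq349`, `B9Ineq349MultiLevelTorus`,
`B9Ineq349FlatTorus` on the `B6MultiLevelTorusOperator` ∕ `FineKernel` carriers; their dictionary to V1's `dE c ∘ (1 − RE D c) ∘ dsE c` is NOT in the tree and NOT claimed),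
the Landau letter (153) for `A′` (n07-w3's `TorusCoverLandau153*`) and Eq. (158) itself (k0-s1-w1's `eq158_flatOps_matrixFields`).  The Laplacian member is NOT on the
(168)∕`Letters10On` path when the head takes the equation's Δ_a-row for the third letter (k0-s1-w1 g4 LOCATED-A₁-CURLCURL-ROW); it is the printed fourth member of
(165)∕(167)∕(10) and the `qΔ` input of the Hodge door.  Flat background only (p. 302).  Nothing of Bałaban's analysis is asserted; `LocalLetters165TopStep(Core)`,
`stub_prop8StepCoP13`, K0⁷ ∕ K1⁷ are NOT closed; N07 is NOT discharged; counts unmoved (28∕28 · 5∕27); one finite 𝕋⁴ programme at fixed ε — R4 closes the conditional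
finite-𝕋⁴ rung `BalabanLadder.UV` only; the YM mass gap (Clay) is NOT proved by any of this; nothing continuum ∕ ℝ⁴ ∕ OS.  No `sorry`, no `def`, no `instance`, no `notation`.

RELATED IN THE TREE, NOT DUPLICATED (stem check 2026-08-28T05:50Z): the slice identities `∂*∂x = Δ_ax = −φ + 𝔐φ`, `R∂*(x − Hβ) = R∂*x`, `𝔐β = ∂*∂(Hβ) + Q*aβ` are route
`UnitScaleTilt`'s `HalvingELJunction.dcsE_dcE_eq_deltaAE_of_slice ∕ dcsE_dcE_eq_of_slice_of_eq_neg_Gt ∕ RE_dsE_sub_hOp ∕ QsE_EE_eq` over `FlatCubeOperators.deltaAE_Gt ∕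
RE_dsE_hOp ∕ QE_hOp`; the Hodge letter solved for `∂*∂` is n07-w4's `N07SecondOrderLetterHodge.dcsE_dcE_apply_eq_laplace_sub` over lit-balaban's
`B8Eq12HodgeLaplacianV1.hodge_apply`; the matrix∕reading edition of the third row is the k0-s1 lane's (k0-s1-w1 g4 CLAIM-1 `curlCurl_row_of_…`); the multiplier letter is
k0-s1-w4's — all USED BY NAME or left to their declarers; this file adds only the (134)–(136) Laplacian∕`∂∂*` rows.

References: [15] (128)–(136) pp. 297–298, (153) p. 301, (157)–(158) p. 302, (165) p. 304; [B6] (2.19) p. 226, (2.34)–(2.35) p. 228; [B5] (1.69) p. 29; [B9] (3.10) p. 392,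
(3.25) p. 394, (3.49) p. 399.
-/

set_option autoImplicit false

noncomputable section

open scoped BigOperators InnerProductSpace

namespace Summit.QuantumFields.YangMills.BalabanUVNodes.N07FlatSecondOrderRowA1

open Literature.MathematicalPhysics.QuantumFieldTheory.Balaban1983to89
open Literature.MathematicalPhysics.QuantumFieldTheory.BalabanImbrieJaffe1984to88.BIJ85AxialPropagator411 (BondSpace)
open LatticeFieldCalculus (laplace)
open B6SectADomainsV1 (Domains)
open B6SectAOperatorsV1 (BondIdx BondIdxSpace QE QsE dE dsE dcE dcsE RE)
open B6SectAVectorModelV1 (GE EE)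
open B6SectA (hOp)
open Summit.QuantumFields.YangMills.Theorems.HalvingELJunction (dcsE_dcE_eq_of_slice_of_eq_neg_Gt RE_dsE_sub_hOp)
open B8Eq12HodgeLaplacianV1 (hodge_apply)

variable {P : Params} (D : Domains P)

/-! ## §1  The `∂∂*`-row on the Landau slice: `∂∂*x = ∂P∂*x`, `P = 1 − R` -/

/-- **`R∂*x = 0 ⇒ ∂∂*x = ∂(1 − R)∂*x`** — on the slice (153) the gradient-of-divergence of `x` IS `∂P∂*x` with `P = 1 − R` ([B9] (3.25); print's carrier:
`B8Ineq192MultiLevelTorus.rProjMLT_eq_one_sub_pProjMLT`), the operator whose kernel (3.49) bounds. [cite: Balaban1985Variational, (134) p.298, (153) p.301; Balaban1985BackgroundPropagators, (3.25) p.394] -/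
theorem dE_dsE_eq_of_landau (c : ℝ) {x : BondSpace P} (hx : RE D c (dsE c x) = 0) :
    dE c (dsE c x) = dE c (dsE c x - RE D c (dsE c x)) := by
  rw [hx, sub_zero]

section Ops

variable {c : ℝ} (hc : c ≠ 0) {w : BondIdx D → ℝ} (hw : ∀ i, 0 < w i)

/-- The same for a tangent component `A′ − Hβ` of a configuration `A′` in the gauge (153): the slice is blind to `H`-images (`R∂*H = 0`, p. 299;
`HalvingELJunction.RE_dsE_sub_hOp`). [cite: Balaban1985Variational, p.299, (153) p.301, (157)–(159) pp.302–303] -/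
theorem dE_dsE_tangent_eq {A' : BondSpace P} (hR : RE D c (dsE c A') = 0) (β : BondIdxSpace D) :
    dE c (dsE c (A' - hOp (GE D hc hw) (QsE D) (EE D hc hw) β)) =
      dE c (dsE c (A' - hOp (GE D hc hw) (QsE D) (EE D hc hw) β) - RE D c (dsE c (A' - hOp (GE D hc hw) (QsE D) (EE D hc hw) β))) :=
  dE_dsE_eq_of_landau D c (by rw [RE_dsE_sub_hOp D hc hw, hR])

/-! ## §2  (134)–(135) at `U₀ = 1`: the componentwise Laplacian of the solution of (158) -/

/-- ★ **(134)–(135) AT `U₀ = 1`**: if `R∂*x = 0` and `x = −G̃φ` (Eq. (158), `φ = (δ∕δA′)V₁(A₁ + HB)`), then for every bond `b = ⟨s, μ⟩`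
`(Δx_μ)(s) = (−φ + Q*(QGQ*)⁻¹QGφ)(b) + (∂(1 − R)∂*x)(b)` — the Hodge letter `Δ = ∂*∂ + ∂∂*` (n07-w4 ∕ lit-balaban, by name), the equation's Δ_a-row on the slice
`∂*∂x = −φ + 𝔐φ` (route `UnitScaleTilt`, by name) and §1; print: *«a sum of Δ_{U₀}A₀ and a bounded operator acting on A₀»* (here `Δ′ = 0`, no curvature terms).
[cite: Balaban1985Variational, (133)–(135) p.298, (158) p.302; Balaban1984PropagatorsI, (1.69) p.29] -/
theorem laplace_eq_of_slice_of_eq_neg_Gt {x : BondSpace P} (φ : BondSpace P) (hx : RE D c (dsE c x) = 0)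
    (hsol : x = -((GE D hc hw - hOp (GE D hc hw) (QsE D) (EE D hc hw) ∘ₗ QE D ∘ₗ GE D hc hw) φ)) (b : PBond P 0) :
    laplace c (fun z => x ⟨z, b.dir⟩) b.src =
      (-φ + QsE D (EE D hc hw (QE D (GE D hc hw φ)))) b + (dE c (dsE c x - RE D c (dsE c x))) b := by
  -- [B5] (1.69) on `ℓ²(bonds)` (lit-balaban `hodge_apply`; solved for `∂*∂` it is n07-w4's `N07SecondOrderLetterHodge.dcsE_dcE_apply_eq_laplace_sub`)
  have h := hodge_apply c x b
  rw [PiLp.add_apply, dcsE_dcE_eq_of_slice_of_eq_neg_Gt D hc hw φ hx hsol] at h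
  rw [← dE_dsE_eq_of_landau D c hx, ← h]

/-- ★ **THE SAME FOR THE TANGENT COMPONENT `A₁ := A′ − H(QA′)`** of a configuration in the gauge (153) with `A₁ + G̃f = 0` — the shape delivered, componentwise, by
`K0Stub1Eq158FlatOpsMatrixFields.eq158_flatOps_matrixFields` (`(A′ − H_V(Q_VA′)) + G̃_V(W A′) = 0`). [cite: Balaban1985Variational, (133)–(135) p.298, (153) p.301, (158) p.302] -/
theorem laplace_tangent_eq_of_eq158 {A' f : BondSpace P}
    (h158 : (A' - hOp (GE D hc hw) (QsE D) (EE D hc hw) (QE D A')) +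
      (GE D hc hw - hOp (GE D hc hw) (QsE D) (EE D hc hw) ∘ₗ QE D ∘ₗ GE D hc hw) f = 0)
    (hR : RE D c (dsE c A') = 0) (b : PBond P 0) :
    laplace c (fun z => (A' - hOp (GE D hc hw) (QsE D) (EE D hc hw) (QE D A')) ⟨z, b.dir⟩) b.src =
      (-f + QsE D (EE D hc hw (QE D (GE D hc hw f)))) b +
        (dE c (dsE c (A' - hOp (GE D hc hw) (QsE D) (EE D hc hw) (QE D A')) -
          RE D c (dsE c (A' - hOp (GE D hc hw) (QsE D) (EE D hc hw) (QE D A'))))) b :=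
  laplace_eq_of_slice_of_eq_neg_Gt D hc hw f (by rw [RE_dsE_sub_hOp D hc hw, hR]) (eq_neg_of_add_eq_zero_left h158) b

/-! ## §3  (136) at `U₀ = 1`: the Laplacian and `∂∂*` rows at one bond -/

/-- ★ **THE THIRD MEMBER OF (165) AT ONE BOND, scalar weighted letter** (bookkeeping over route `UnitScaleTilt`'s slice identity `∂*∂x = −φ + Q*(QGQ*)⁻¹QGφ`,
`HalvingELJunction.dcsE_dcE_eq_of_slice_of_eq_neg_Gt`, BY NAME): for a weight `ω ≥ 0` at `b`, the V-slot row `ω|φ(b)| ≤ β₁` and the multiplier row `ω|(𝔐φ)(b)| ≤ β₂` give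
`ω·|(∂*∂x)(b)| ≤ β₁ + β₂` — print's *«the right-hand side of (133) can be estimated by O(1)C₁B₃ε₁(Lʲη)⁻³»* for this member; NO propagator row and NO (3.49) enter (the
matrix∕reading edition at NODE 00's kernel extensions is the k0-s1 lane's `K0Stub1CurlCurlRowOfEq158`, not repeated). [cite: Balaban1985Variational, (133) p.298, (165) p.304] -/
theorem curlCurlLetter_of_eq158 {x : BondSpace P} (φ : BondSpace P) (hx : RE D c (dsE c x) = 0)
    (hsol : x = -((GE D hc hw - hOp (GE D hc hw) (QsE D) (EE D hc hw) ∘ₗ QE D ∘ₗ GE D hc hw) φ)) (b : PBond P 0) {ω β₁ β₂ : ℝ} (hω : 0 ≤ ω)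
    (h1 : ω * |φ b| ≤ β₁) (h2 : ω * |(QsE D (EE D hc hw (QE D (GE D hc hw φ)))) b| ≤ β₂) :
    ω * |(dcsE c (dcE c x)) b| ≤ β₁ + β₂ := by
  rw [dcsE_dcE_eq_of_slice_of_eq_neg_Gt D hc hw φ hx hsol, PiLp.add_apply, PiLp.neg_apply]
  calc ω * |-(φ b) + (QsE D (EE D hc hw (QE D (GE D hc hw φ)))) b|
      ≤ ω * (|φ b| + |(QsE D (EE D hc hw (QE D (GE D hc hw φ)))) b|) := by
        refine mul_le_mul_of_nonneg_left ?_ hω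
        calc |-(φ b) + (QsE D (EE D hc hw (QE D (GE D hc hw φ)))) b|
            ≤ |-(φ b)| + |(QsE D (EE D hc hw (QE D (GE D hc hw φ)))) b| := abs_add_le _ _
          _ = |φ b| + |(QsE D (EE D hc hw (QE D (GE D hc hw φ)))) b| := by rw [abs_neg]
    _ = ω * |φ b| + ω * |(QsE D (EE D hc hw (QE D (GE D hc hw φ)))) b| := mul_add _ _ _
    _ ≤ β₁ + β₂ := add_le_add h1 h2

/-- ★★ **(136) AT `U₀ = 1`, ROW FORM — the `qΔ`∕`qP` inputs of the Hodge door `N07SecondOrderLetterHodge.letters10On_of_realRows_hodge`**: for `x` on the slice with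
`x = −G̃φ`, at a bond `b`: from the V-slot `|φ(b)| ≤ β₁`, the multiplier row `|(Q*(QGQ*)⁻¹QGφ)(b)| ≤ β₂`, a first-letter bound `ω₁|x| ≤ r` and the `DPD*` ROW AT `b`
(`hDPD`: [B9] (3.49) summed with [B6] Lemma 2.1 — HYPOTHESIS), **`|(Δx_{dir b})(src b)| ≤ β₁ + β₂ + C·r` and `|(∂∂*x)(b)| ≤ C·r`**.
[cite: Balaban1985Variational, (133)–(136) p.298, (165) p.304; Balaban1985BackgroundPropagators, (3.49) p.399; Balaban1984PropagatorsII, Lemma 2.1 (2.60)–(2.61) p.234] -/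
theorem hodgeRows_of_eq158 {x : BondSpace P} (φ : BondSpace P) (hx : RE D c (dsE c x) = 0)
    (hsol : x = -((GE D hc hw - hOp (GE D hc hw) (QsE D) (EE D hc hw) ∘ₗ QE D ∘ₗ GE D hc hw) φ)) (b : PBond P 0) {β₁ β₂ C r : ℝ}
    (h1 : |φ b| ≤ β₁) (h2 : |(QsE D (EE D hc hw (QE D (GE D hc hw φ)))) b| ≤ β₂) (ω₁ : PBond P 0 → ℝ) (hr : ∀ b', ω₁ b' * |x b'| ≤ r)
    (hDPD : ∀ X : BondSpace P, (∀ b', ω₁ b' * |X b'| ≤ r) → |(dE c (dsE c X - RE D c (dsE c X))) b| ≤ C * r) :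
    |laplace c (fun z => x ⟨z, b.dir⟩) b.src| ≤ β₁ + β₂ + C * r ∧ |(dE c (dsE c x)) b| ≤ C * r := by
  have hP : |(dE c (dsE c x)) b| ≤ C * r := by
    rw [dE_dsE_eq_of_landau D c hx]
    exact hDPD x hr
  refine ⟨?_, hP⟩
  rw [laplace_eq_of_slice_of_eq_neg_Gt D hc hw φ hx hsol b, ← dE_dsE_eq_of_landau D c hx, PiLp.add_apply, PiLp.neg_apply]
  calc |-(φ b) + (QsE D (EE D hc hw (QE D (GE D hc hw φ)))) b + (dE c (dsE c x)) b|
      ≤ |-(φ b) + (QsE D (EE D hc hw (QE D (GE D hc hw φ)))) b| + |(dE c (dsE c x)) b| := abs_add_le _ _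
    _ ≤ (|-(φ b)| + |(QsE D (EE D hc hw (QE D (GE D hc hw φ)))) b|) + |(dE c (dsE c x)) b| := by
        gcongr
        exact abs_add_le _ _
    _ ≤ (β₁ + β₂) + C * r := by
        rw [abs_neg]
        gcongr

/-- ★ **THE SAME FOR THE TANGENT COMPONENT `A₁ := A′ − H(QA′)`** of a configuration in the gauge (153) with `A₁ + G̃f = 0`.
[cite: Balaban1985Variational, (133)–(136) p.298, (153) p.301, (158) p.302, (165) p.304; Balaban1985BackgroundPropagators, (3.49) p.399] -/
theorem hodgeRows_tangent_of_eq158 {A' f : BondSpace P}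
    (h158 : (A' - hOp (GE D hc hw) (QsE D) (EE D hc hw) (QE D A')) +
      (GE D hc hw - hOp (GE D hc hw) (QsE D) (EE D hc hw) ∘ₗ QE D ∘ₗ GE D hc hw) f = 0)
    (hR : RE D c (dsE c A') = 0) (b : PBond P 0) {β₁ β₂ C r : ℝ}
    (h1 : |f b| ≤ β₁) (h2 : |(QsE D (EE D hc hw (QE D (GE D hc hw f)))) b| ≤ β₂) (ω₁ : PBond P 0 → ℝ)
    (hr : ∀ b', ω₁ b' * |(A' - hOp (GE D hc hw) (QsE D) (EE D hc hw) (QE D A')) b'| ≤ r)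
    (hDPD : ∀ X : BondSpace P, (∀ b', ω₁ b' * |X b'| ≤ r) → |(dE c (dsE c X - RE D c (dsE c X))) b| ≤ C * r) :
    |laplace c (fun z => (A' - hOp (GE D hc hw) (QsE D) (EE D hc hw) (QE D A')) ⟨z, b.dir⟩) b.src| ≤ β₁ + β₂ + C * r ∧
      |(dE c (dsE c (A' - hOp (GE D hc hw) (QsE D) (EE D hc hw) (QE D A')))) b| ≤ C * r :=
  hodgeRows_of_eq158 D hc hw f (by rw [RE_dsE_sub_hOp D hc hw, hR]) (eq_neg_of_add_eq_zero_left h158) b h1 h2 ω₁ hr hDPD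

/-- **WEIGHTED TWIN** (the `wt 3`-currency of `K0Stub1Letter165OfCriticalFlatOps`): for a weight `ω ≥ 0` at the bond, `ω·|(Δx_{dir b})(src b)| ≤ β₁ + β₂ + β₃` from the
three weighted rows at `b` (V-slot, multiplier, `∂(1−R)∂*`). [cite: Balaban1985Variational, (136) p.298, (165) p.304] -/
theorem laplaceLetter_of_eq158 {x : BondSpace P} (φ : BondSpace P) (hx : RE D c (dsE c x) = 0)
    (hsol : x = -((GE D hc hw - hOp (GE D hc hw) (QsE D) (EE D hc hw) ∘ₗ QE D ∘ₗ GE D hc hw) φ)) (b : PBond P 0) {ω β₁ β₂ β₃ : ℝ} (hω : 0 ≤ ω)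
    (h1 : ω * |φ b| ≤ β₁) (h2 : ω * |(QsE D (EE D hc hw (QE D (GE D hc hw φ)))) b| ≤ β₂)
    (h3 : ω * |(dE c (dsE c x - RE D c (dsE c x))) b| ≤ β₃) :
    ω * |laplace c (fun z => x ⟨z, b.dir⟩) b.src| ≤ β₁ + β₂ + β₃ := by
  rw [laplace_eq_of_slice_of_eq_neg_Gt D hc hw φ hx hsol b, PiLp.add_apply, PiLp.neg_apply]
  calc ω * |-(φ b) + (QsE D (EE D hc hw (QE D (GE D hc hw φ)))) b + (dE c (dsE c x - RE D c (dsE c x))) b|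
      ≤ ω * (|φ b| + |(QsE D (EE D hc hw (QE D (GE D hc hw φ)))) b| + |(dE c (dsE c x - RE D c (dsE c x))) b|) := by
        refine mul_le_mul_of_nonneg_left ?_ hω
        calc |-(φ b) + (QsE D (EE D hc hw (QE D (GE D hc hw φ)))) b + (dE c (dsE c x - RE D c (dsE c x))) b|
            ≤ |-(φ b) + (QsE D (EE D hc hw (QE D (GE D hc hw φ)))) b| + |(dE c (dsE c x - RE D c (dsE c x))) b| := abs_add_le _ _
          _ ≤ (|-(φ b)| + |(QsE D (EE D hc hw (QE D (GE D hc hw φ)))) b|) + |(dE c (dsE c x - RE D c (dsE c x))) b| := by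
              gcongr
              exact abs_add_le _ _
          _ = |φ b| + |(QsE D (EE D hc hw (QE D (GE D hc hw φ)))) b| + |(dE c (dsE c x - RE D c (dsE c x))) b| := by rw [abs_neg]
    _ = ω * |φ b| + ω * |(QsE D (EE D hc hw (QE D (GE D hc hw φ)))) b| + ω * |(dE c (dsE c x - RE D c (dsE c x))) b| := by ring
    _ ≤ β₁ + β₂ + β₃ := by linarith

end Ops

end Summit.QuantumFields.YangMills.BalabanUVNodes.N07FlatSecondOrderRowA1

end
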